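import Mathlib
import HarnessLib

/-!
# Crux `EulerZoomLiouville.PowerGaugeEulerLiouville` (stmt-NavierStokesRegularity-19832), weak stratum, line `weak_eulerian` (E2):
# TWO LIMIT TOOLS FOR THE RENORMALISATION STEP (pure measure theory on `ℝ³`)

Route №10 `EulerZoomLiouville` (NavierStokesRegularity), crux E = stmt-NavierStokesRegularity-19832; width seat ns-ezl-w2 g7 under the LEAD ns-typeII-p2.
Fourth brick of `stub_renormalisation` (E2): the two passages to the limit in `∫ β(Θₙ)(cψ + Dψ[W]) = ∫ ψ Dβ(Θₙ)[Xₙ]`, `Θₙ → Θ` a.e.,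
`Xₙ → X` in `L¹_loc`, `β` bounded with bounded derivative, `ψ` continuous with compact support:

* `tendsto_integral_comp_mul_of_ae_tendsto` — `∫ β(Θₙ y) h(y) dy → ∫ β(Θ y) h(y) dy` for `h ∈ L¹`, `β` continuous and bounded, `Θₙ → Θ` a.e.
  (dominated convergence);
* `tendsto_integral_test_mul_clm_apply` — `∫ ψ(y) Aₙ(y)[Xₙ(y)] dy → ∫ ψ(y) A(y)[X(y)] dy` for linear-functional-valued `Aₙ → A` a.e. with
  `‖Aₙ‖, ‖A‖ ≤ C`, `Xₙ, X ∈ L¹_loc` with `∫_{B_R} ‖Xₙ − X‖ → 0`, and `ψ` continuous supported in `B_R`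
  (split `Aₙ[Xₙ] = Aₙ[Xₙ − X] + Aₙ[X]`: the first is `O(∫_{B_R}‖Xₙ − X‖)`, the second converges by dominated convergence).
[folklore; Evans2010 App. C.4 / E.3 (dominated convergence)]

WHAT THIS IS NOT: not NS, not E, not E2 — analysis plumbing `--supports` stmt-19832; 19832 is OPEN.
-/

noncomputable section

-- flat `Theorems/<Route><Decl>…` files of one crux share the namespace of the crux (tree convention)
set_option linter.dupNamespace false

open MeasureTheory Set Filter Topology Metric Function TopologicalSpace ContinuousLinearMap
open scoped ENNReal NNReal RealInnerProductSpace

namespace Summit.NavierStokesRegularity.NavierStokesRegularity.Theorems.PowerGaugeEulerLiouville.WeakEulerian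

section BetaLimit

variable {F : Type*} [NormedAddCommGroup F]

/-- **`∫ β(Θₙ) h → ∫ β(Θ) h`** for `h ∈ L¹`, `β` continuous with `‖β‖ ≤ C`, and `Θₙ → Θ` a.e. (dominated convergence).
[folklore; Evans2010 App. E.3 (dominated convergence)] -/
theorem tendsto_integral_comp_mul_of_ae_tendsto {Θ : ℕ → EuclideanSpace ℝ (Fin 3) → F} {Θ' : EuclideanSpace ℝ (Fin 3) → F}
    (hΘm : ∀ n, AEStronglyMeasurable (Θ n) volume)
    (hΘt : ∀ᵐ y ∂(volume : Measure (EuclideanSpace ℝ (Fin 3))), Tendsto (fun n => Θ n y) atTop (𝓝 (Θ' y)))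
    {β : F → ℝ} (hβc : Continuous β) {C : ℝ} (hβb : ∀ w, ‖β w‖ ≤ C)
    {h : EuclideanSpace ℝ (Fin 3) → ℝ} (hh : Integrable h volume) :
    Tendsto (fun n => ∫ y, β (Θ n y) * h y) atTop (𝓝 (∫ y, β (Θ' y) * h y)) := by
  refine tendsto_integral_of_dominated_convergence (fun y => C * ‖h y‖) (fun n => ?_) (hh.norm.const_mul C) (fun n => ?_) ?_
  · exact (hβc.comp_aestronglyMeasurable (hΘm n)).mul hh.1
  · exact Eventually.of_forall fun y => by
      rw [norm_mul]; exact mul_le_mul_of_nonneg_right (hβb _) (norm_nonneg _)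
  · filter_upwards [hΘt] with y hy
    exact ((hβc.tendsto _).comp hy).mul tendsto_const_nhds

end BetaLimit

section PairingLimit

/-- `∫ ψ A[X]`-type integrand is integrable: `ψ` continuous with compact support, `‖A‖ ≤ C` a.e.-measurable, `X ∈ L¹_loc`. [folklore] -/
theorem integrable_test_mul_clm_apply {ψ : EuclideanSpace ℝ (Fin 3) → ℝ} (hψc : Continuous ψ) (hψs : HasCompactSupport ψ)
    {A : EuclideanSpace ℝ (Fin 3) → EuclideanSpace ℝ (Fin 3) →L[ℝ] ℝ} (hAm : AEStronglyMeasurable A volume) {C : ℝ}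
    (hAb : ∀ y, ‖A y‖ ≤ C) {X : EuclideanSpace ℝ (Fin 3) → EuclideanSpace ℝ (Fin 3)} (hX : LocallyIntegrable X volume) :
    Integrable (fun y => ψ y * A y (X y)) volume := by
  have hC : 0 ≤ C := (norm_nonneg _).trans (hAb 0)
  have hdom : Integrable (fun y => ψ y • X y) volume := hX.integrable_smul_left_of_hasCompactSupport hψc hψs
  have hm : AEStronglyMeasurable (fun y => ψ y * A y (X y)) volume := by
    refine hψc.aestronglyMeasurable.mul ?_
    exact Continuous.comp_aestronglyMeasurable₂
      (g := fun (L : EuclideanSpace ℝ (Fin 3) →L[ℝ] ℝ) (v : EuclideanSpace ℝ (Fin 3)) => L v)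
      (isBoundedBilinearMap_apply (𝕜 := ℝ) (E := EuclideanSpace ℝ (Fin 3)) (F := ℝ)).continuous hAm hX.aestronglyMeasurable
  refine (hdom.norm.const_mul C).mono' hm (Eventually.of_forall fun y => ?_)
  rw [norm_mul, norm_smul]
  calc ‖ψ y‖ * ‖A y (X y)‖ ≤ ‖ψ y‖ * (C * ‖X y‖) :=
        mul_le_mul_of_nonneg_left ((A y).le_of_opNorm_le (hAb y) _) (norm_nonneg _)
    _ = C * (‖ψ y‖ * ‖X y‖) := by ring

/-- **`∫ ψ Aₙ[Xₙ] → ∫ ψ A[X]`**: `ψ` continuous with support in `B_R`, linear-functional-valued `Aₙ → A` a.e. with `‖Aₙ‖, ‖A‖ ≤ C`,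
`Xₙ, X ∈ L¹_loc` with `∫_{B_R} ‖Xₙ − X‖ → 0` (the bound `‖A‖ ≤ C` also fixes the sign of `C`). [folklore; Evans2010 App. E.3] -/
theorem tendsto_integral_test_mul_clm_apply {ψ : EuclideanSpace ℝ (Fin 3) → ℝ} (hψc : Continuous ψ) (hψs : HasCompactSupport ψ)
    {R : ℝ} (hψR : support ψ ⊆ ball (0 : EuclideanSpace ℝ (Fin 3)) R)
    {A : ℕ → EuclideanSpace ℝ (Fin 3) → EuclideanSpace ℝ (Fin 3) →L[ℝ] ℝ} {A' : EuclideanSpace ℝ (Fin 3) → EuclideanSpace ℝ (Fin 3) →L[ℝ] ℝ}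
    (hAm : ∀ n, AEStronglyMeasurable (A n) volume) {C : ℝ}
    (hAb : ∀ n y, ‖A n y‖ ≤ C) (hA'b : ∀ y, ‖A' y‖ ≤ C)
    (hAt : ∀ᵐ y ∂(volume : Measure (EuclideanSpace ℝ (Fin 3))), Tendsto (fun n => A n y) atTop (𝓝 (A' y)))
    {X : ℕ → EuclideanSpace ℝ (Fin 3) → EuclideanSpace ℝ (Fin 3)} {X' : EuclideanSpace ℝ (Fin 3) → EuclideanSpace ℝ (Fin 3)}
    (hXl : ∀ n, LocallyIntegrable (X n) volume) (hX'l : LocallyIntegrable X' volume)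
    (hXt : Tendsto (fun n => ∫⁻ y in ball (0 : EuclideanSpace ℝ (Fin 3)) R, ‖X n y - X' y‖ₑ) atTop (𝓝 0)) :
    Tendsto (fun n => ∫ y, ψ y * A n y (X n y)) atTop (𝓝 (∫ y, ψ y * A' y (X' y))) := by
  have hC : 0 ≤ C := (norm_nonneg _).trans (hA'b 0)
  obtain ⟨M, hM⟩ := hψc.bounded_above_of_compact_support hψs
  have hM0 : 0 ≤ M := (norm_nonneg _).trans (hM 0)
  -- ### the split `Aₙ[Xₙ] = Aₙ[Xₙ − X] + Aₙ[X]`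
  have hI1 : ∀ n, Integrable (fun y => ψ y * A n y (X n y - X' y)) volume := fun n =>
    integrable_test_mul_clm_apply hψc hψs (hAm n) (hAb n) ((hXl n).sub hX'l)
  have hI2 : ∀ n, Integrable (fun y => ψ y * A n y (X' y)) volume := fun n =>
    integrable_test_mul_clm_apply hψc hψs (hAm n) (hAb n) hX'l
  have hsplit : ∀ n, ∫ y, ψ y * A n y (X n y) = (∫ y, ψ y * A n y (X n y - X' y)) + ∫ y, ψ y * A n y (X' y) := by
    intro n
    rw [← integral_add (hI1 n) (hI2 n)]
    refine integral_congr_ae (Eventually.of_forall fun y => ?_)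
    simp only [map_sub]; ring
  simp_rw [hsplit]
  rw [← zero_add (∫ y, ψ y * A' y (X' y))]
  refine Tendsto.add ?_ ?_
  · -- ### the first term is `O(∫_{B_R} ‖Xₙ − X‖)`
    have hbound : ∀ n, ‖∫ y, ψ y * A n y (X n y - X' y)‖ ≤
        M * C * (∫⁻ y in ball (0 : EuclideanSpace ℝ (Fin 3)) R, ‖X n y - X' y‖ₑ).toReal := by
      intro n
      have hint : IntegrableOn (fun y => ‖X n y - X' y‖) (ball (0 : EuclideanSpace ℝ (Fin 3)) R) volume :=
        (((hXl n).sub hX'l).integrableOn_isCompact (isCompact_closedBall 0 R)).mono_set ball_subset_closedBall |>.norm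
      have hle : ∀ y, ‖ψ y * A n y (X n y - X' y)‖ ≤
          (ball (0 : EuclideanSpace ℝ (Fin 3)) R).indicator (fun y => M * C * ‖X n y - X' y‖) y := by
        intro y
        by_cases hy : y ∈ ball (0 : EuclideanSpace ℝ (Fin 3)) R
        · rw [indicator_of_mem hy, norm_mul]
          calc ‖ψ y‖ * ‖A n y (X n y - X' y)‖ ≤ M * (C * ‖X n y - X' y‖) :=
                mul_le_mul (hM y) ((A n y).le_of_opNorm_le (hAb n y) _) (norm_nonneg _) hM0
            _ = M * C * ‖X n y - X' y‖ := by ring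
        · have h0 : ψ y = 0 := by
            by_contra h; exact hy (hψR (mem_support.2 h))
          rw [indicator_of_notMem hy, h0, zero_mul, norm_zero]
      calc ‖∫ y, ψ y * A n y (X n y - X' y)‖ ≤ ∫ y, ‖ψ y * A n y (X n y - X' y)‖ := norm_integral_le_integral_norm _
        _ ≤ ∫ y, (ball (0 : EuclideanSpace ℝ (Fin 3)) R).indicator (fun y => M * C * ‖X n y - X' y‖) y :=
            integral_mono_of_nonneg (Eventually.of_forall fun y => norm_nonneg _)
              ((show IntegrableOn (fun y => M * C * ‖X n y - X' y‖) (ball (0 : EuclideanSpace ℝ (Fin 3)) R) volume from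
                hint.const_mul (M * C)).integrable_indicator measurableSet_ball) (Eventually.of_forall hle)
        _ = M * C * ∫ y in ball (0 : EuclideanSpace ℝ (Fin 3)) R, ‖X n y - X' y‖ := by
            rw [integral_indicator measurableSet_ball, integral_const_mul]
        _ = M * C * (∫⁻ y in ball (0 : EuclideanSpace ℝ (Fin 3)) R, ‖X n y - X' y‖ₑ).toReal := by
            rw [integral_norm_eq_lintegral_enorm (f := fun y => X n y - X' y) (((hXl n).sub hX'l).aestronglyMeasurable.restrict)]
    have hto : Tendsto (fun n => M * C * (∫⁻ y in ball (0 : EuclideanSpace ℝ (Fin 3)) R, ‖X n y - X' y‖ₑ).toReal)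
        atTop (𝓝 0) := by
      have h := (ENNReal.tendsto_toReal ENNReal.zero_ne_top).comp hXt
      rw [ENNReal.toReal_zero] at h
      simpa using h.const_mul (M * C)
    exact squeeze_zero_norm hbound hto
  · -- ### the second term converges by dominated convergence
    have hdom : Integrable (fun y => ψ y • X' y) volume := hX'l.integrable_smul_left_of_hasCompactSupport hψc hψs
    refine tendsto_integral_of_dominated_convergence (fun y => C * ‖ψ y • X' y‖) (fun n => (hI2 n).1) (hdom.norm.const_mul C)
      (fun n => Eventually.of_forall fun y => ?_) ?_
    · rw [norm_mul, norm_smul]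
      calc ‖ψ y‖ * ‖A n y (X' y)‖ ≤ ‖ψ y‖ * (C * ‖X' y‖) :=
            mul_le_mul_of_nonneg_left ((A n y).le_of_opNorm_le (hAb n y) _) (norm_nonneg _)
        _ = C * (‖ψ y‖ * ‖X' y‖) := by ring
    · filter_upwards [hAt] with y hy
      have h := ((ContinuousLinearMap.apply ℝ ℝ (X' y)).continuous.tendsto (A' y)).comp hy
      exact tendsto_const_nhds.mul h

end PairingLimit

end Summit.NavierStokesRegularity.NavierStokesRegularity.Theorems.PowerGaugeEulerLiouville.WeakEulerian

end
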